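import Mathlib
import Literature.MathematicalPhysics.QuantumFieldTheory.Balaban1983to89.B12Decay510
import Literature.MathematicalPhysics.QuantumFieldTheory.Balaban1983to89.TreeLengthCubeSystem

/-!
# Bałaban, *Renormalization Group Approach to Lattice Gauge Field Theories. I* (CMP 109, 1987) — (5.10) p. 293:
the GEOMETRIC LEAVES of `B12Decay510` DISCHARGED on the concrete window system of `TreeLengthCubeSystem`

[Balaban1987RG1] T. Bałaban, Commun. Math. Phys. **109** (1987) 249–301 (= "B12" of the cell census).  Companion
modules: `…Balaban1983to89.B12Decay510` (unit b03 gen 3: (5.10) *"The representation (4.37) yields the following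
inequality ∣Π_{μν}(x − y)∣ ≤ O(1)E₀ exp(−δ₁∣x − y∣)"* kernel-derived from NAMED LEAVES over abstract carriers
`SiteGeometry C Λ`, with the printed example δ₁ = ½ min{δ₀, κM⁻¹}), `…Balaban1983to89.TreeLength` /
`…Balaban1983to89.TreeLengthCubeSystem` (unit pv22: the linear size d_j(X) of p. 257 as the infimum `treeLen` of the
lengths of the admissible polygonal graphs of a face-connected family of unit cubes, and the localization domains of
a finite window `B ⊂ ℤᵈ` as a concrete `LocDomainSys` / `CubeSystem` with the degree bound `degreeLE` and the volume
leaf `volumeLeaf` PROVED).  Nothing existing is modified; this module only imports the two.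

## What this module does (cell GAPS G-b03g3-1, leaves (b), (c), (d))

`B12Decay510.decay510_of_analytic_leaves` derives (5.10) from: the analyticity (4.4) and the bound (1.18) of the
terms of (4.37), the representation (4.35) at r = 2, the decay of the linearized minimizers (p. 282), AND three
geometric leaves stated as hypotheses over an abstract `SiteGeometry` — (b) `GeomLeaf` (∣x − y∣ ≤ dist(x, X) +
dist(y, X) + M(d_j(X) + c₁)), (c) `CubeSumLeaf` (Σ_□ e^{−a·dist(x,□)} ≤ K₁), (d) `TreeLeaf` (Σ_{X⊃□} e^{−κ′d_j(X)}
≤ K₀).  Here all three are THEOREMS for the concrete window system `TreeLengthCubeSystem.cubeSys B` read at the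
resolution of the cubes — sites := cube indices z ∈ ℤᵈ (`B13ScaleTransfer.Pt d`), distances := the ℓ¹ lattice
distance `B12Sec2to5.l1`, d_j := `TreeLength.treeLen` — with explicit constants:

* Part 1 (the one new geometric fact): **the sup-diameter of a face-connected family X of unit cubes is at most
  `treeLen X + 2`** (`dist_corner_le_treeLen`): any admissible graph T is connected and meets the cubes of x and y;
  the i-th coordinate projection of its carrier is a connected subset of ℝ containing pᵢ and qᵢ, hence ⊇ [pᵢ, qᵢ],
  and it is covered by the projections of the segments of T, whose Lebesgue measures add up to at most `len T`
  (`volume_image_carrier_le`); so ∣pᵢ − qᵢ∣ ≤ len T (`dist_le_len`), and the two unit cubes add 2.  Hence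
  ∣x − y∣₁ ≤ d(d_j(X) + 2) for x, y ∈ X (`l1_sub_le_treeLen`).
* Part 2: the `SiteGeometry` of a window (`geom B`: dist(z, □) := ∣z − □∣₁, dist(z, X) := min over the cubes of X,
  attained at `nearest`), and the three leaves: `geomLeaf` with (M, c₁) := (d, 2) — the factor d is the ℓ¹/sup
  conversion, the cubes being unit cubes after the rescaling of p. 257 (*"we rescale the space, so that cubes from
  π_j become unit cubes"*); `cubeSumLeaf` with K₁(a) := Σ_{z∈ℤᵈ} e^{−a∣z∣₁} (`B12Sec2to5.summable_exp_neg_l1`);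
  `treeLeaf` := `B12Decay510.treeLeaf_of_volumeLeaf` on pv22's `degreeLE` / `volumeLeaf`, at κ ≥ 2κ₀(4·2ᵈ, 2d).
* Part 3: (5.10) on one window (`abs_twoPoint_le_window`) and for an exhausting family of windows with the limit
  (5.1) (`decay510_window`), landing in `B12Sec2to5.Decay510 P C (delta1 δ₀ κ d)` with
  C = 4E₀α₂⁻² B₃² e^{2dδ₁} K₀(4·2ᵈ, 2d) K₁(δ₀/2): EVERY GEOMETRIC HYPOTHESIS IS GONE; what remains is exactly the
  analytic input of the paper — (4.4) analyticity (`han`), (1.18) (`h118`), the representation (4.35)/(4.37) at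
  r = 2 (`hrepr`), the minimizer decay p. 282 / [15] Sect. G (`hh`) — and the limit (5.1) (`hlim`).

## DIVERGENCE (recorded in the cell file as D-b03.11)

In print the sites x, y of (5.10) are points of the unit lattice and the cubes □ ∈ π_j have side M; the window
model of `TreeLengthCubeSystem` has unit cubes indexed by ℤᵈ and no finer site lattice, so this instance identifies
a site with (the index of) its cube: it is B12's geometry coarse-grained by the factor M, in which the printed
"M" of δ₁ = ½ min{δ₀, κM⁻¹} becomes the norm-conversion constant d (δ₁ = ½ min{δ₀, κ/d}) and c₁ = 2.  The abstract
theorem `B12Decay510.decay510_of_analytic_leaves` keeps the printed shape; this module shows that its geometric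
leaves are satisfiable with finite explicit constants in the model the tree already has, nothing more.

v2 (DOCFIX, docstrings only, answering the cross-read G-pv13g2-1): the three diameter bounds of Part 1 are re-tagged as
derived-here (p.257 prints only the DEFINITION of d_j; the inequalities are NOT PRINTED in B12), and `treeLeaf` now cites B12
(0.25)–(0.26) with B12's own phrase and [II] (1.26) for the phrase "for κ sufficiently large".  No declaration changed.
-/

namespace Literature.MathematicalPhysics.QuantumFieldTheory.Balaban1983to89.B12Decay510Window

open Literature.MathematicalPhysics.QuantumFieldTheory.Balaban1983to89
open Literature.MathematicalPhysics.QuantumFieldTheory.Balaban1983to89.B13ScaleTransfer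
open Literature.MathematicalPhysics.QuantumFieldTheory.Balaban1983to89.TreeLength
open Literature.MathematicalPhysics.QuantumFieldTheory.Balaban1983to89.TreeLengthCubeSystem
open Literature.MathematicalPhysics.QuantumFieldTheory.Balaban1983to89.B12TreeDecay
open Literature.MathematicalPhysics.QuantumFieldTheory.Balaban1983to89.B12Decay510
open Literature.MathematicalPhysics.QuantumFieldTheory.Balaban1983to89.B12Sec2to5 (l1 l1_nonneg)
open Set MeasureTheory Metric Filter Topology

variable {d : ℕ}

/-! ## 1. The diameter of a localization domain is at most its tree length plus two -/

/-- A coordinate of a point of a segment lies between the same coordinates of the endpoints. [folklore] -/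
theorem apply_mem_uIcc_of_mem_segment {x y p : RPt d} (hp : p ∈ segment ℝ x y) (i : Fin d) :
    p i ∈ uIcc (x i) (y i) := by
  obtain ⟨a, b, ha, hb, hab, rfl⟩ := hp
  simp only [Pi.add_apply, Pi.smul_apply, smul_eq_mul]
  rw [Set.mem_uIcc]
  have ex : a * x i + b * x i = x i := by rw [← add_mul, hab, one_mul]
  have ey : a * y i + b * y i = y i := by rw [← add_mul, hab, one_mul]
  rcases le_total (x i) (y i) with h | h
  · have h1 := mul_le_mul_of_nonneg_left h ha
    have h2 := mul_le_mul_of_nonneg_left h hb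
    left; constructor <;> linarith
  · have h1 := mul_le_mul_of_nonneg_left h ha
    have h2 := mul_le_mul_of_nonneg_left h hb
    right; constructor <;> linarith

/-- The i-th coordinate projection of a segment has Lebesgue measure at most the (sup-metric) length of the
segment. [folklore] -/
theorem volume_image_segment_le (x y : RPt d) (i : Fin d) :
    volume ((fun p : RPt d => p i) '' segment ℝ x y) ≤ ENNReal.ofReal (dist x y) := by
  calc volume ((fun p : RPt d => p i) '' segment ℝ x y) ≤ volume (uIcc (x i) (y i)) := by
        refine measure_mono ?_
        rintro _ ⟨p, hp, rfl⟩
        exact apply_mem_uIcc_of_mem_segment hp i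
    _ = ENNReal.ofReal |y i - x i| := Real.volume_interval
    _ ≤ ENNReal.ofReal (dist x y) := by
        refine ENNReal.ofReal_le_ofReal ?_
        rw [abs_sub_comm, ← Real.dist_eq]
        exact dist_le_pi_dist x y i

/-- The i-th coordinate projection of a polygonal graph has Lebesgue measure at most the length of the graph
(subadditivity over its segments). [folklore] -/
theorem volume_image_carrier_le (T : List (Seg d)) (i : Fin d) :
    volume ((fun p : RPt d => p i) '' carrier T) ≤ ENNReal.ofReal (len T) := by
  induction T with
  | nil => simp
  | cons s T ih =>
    rw [carrier_cons, image_union, len_cons, ENNReal.ofReal_add dist_nonneg (len_nonneg T)]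
    exact (measure_union_le _ _).trans (add_le_add (volume_image_segment_le s.1 s.2 i) ih)

/-- **Two points of a connected polygonal graph are at sup-distance at most its length** (p. 257 [9]: the graphs
are *"in the continuous space"*, lengths in the rescaled picture): each coordinate projection of the carrier is a
connected subset of ℝ containing both coordinates, hence the interval between them, and is covered by the
projections of the segments. (Locus of the DEFINITION of d_j: Balaban1987RG1 p.257; the bound itself is NOT PRINTED in B12 — it is
derived here.) [folklore] -/
theorem dist_le_len {T : List (Seg d)} (hT : IsPreconnected (carrier T)) {p q : RPt d}
    (hp : p ∈ carrier T) (hq : q ∈ carrier T) : dist p q ≤ len T := by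
  rw [dist_pi_le_iff (len_nonneg T)]
  intro i
  have himg : IsPreconnected ((fun v : RPt d => v i) '' carrier T) :=
    hT.image _ (continuous_apply i).continuousOn
  have key : ∀ a b : ℝ, a ∈ (fun v : RPt d => v i) '' carrier T → b ∈ (fun v : RPt d => v i) '' carrier T →
      a ≤ b → b - a ≤ len T := by
    intro a b ha hb _
    have hsub : Icc a b ⊆ (fun v : RPt d => v i) '' carrier T := himg.Icc_subset ha hb
    have h1 : ENNReal.ofReal (b - a) ≤ ENNReal.ofReal (len T) :=
      calc ENNReal.ofReal (b - a) = volume (Icc a b) := Real.volume_Icc.symm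
        _ ≤ volume ((fun v : RPt d => v i) '' carrier T) := measure_mono hsub
        _ ≤ ENNReal.ofReal (len T) := volume_image_carrier_le T i
    exact (ENNReal.ofReal_le_ofReal_iff (len_nonneg T)).1 h1
  rw [Real.dist_eq]
  rcases le_total (p i) (q i) with h | h
  · rw [abs_sub_comm, abs_of_nonneg (sub_nonneg.2 h)]
    exact key _ _ (mem_image_of_mem _ hp) (mem_image_of_mem _ hq) h
  · rw [abs_of_nonneg (sub_nonneg.2 h)]
    exact key _ _ (mem_image_of_mem _ hq) (mem_image_of_mem _ hp) h

/-- **The sup-diameter of a localization domain is at most d_j(X) + 2** (p. 257 [9], verbatim: *"A length of a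
shortest graph in this class, divided by M, is the linear size of X, and is denoted by d_j(X)"* — every admissible
graph meets the cubes of x and of y, its length bounds the distance of the two meeting points by `dist_le_len`, and
each unit cube has diameter 1). (Locus of the DEFINITION of d_j: Balaban1987RG1 p.257; the bound itself is NOT PRINTED in B12 — it is
derived here.) [folklore] -/
theorem dist_corner_le_treeLen {X : Finset (Pt d)} (hX : X.Nonempty) (hc : FaceConnected X) {x y : Pt d}
    (hx : x ∈ X) (hy : y ∈ X) : dist (corner x) (corner y) ≤ treeLen X + 2 := by
  obtain ⟨T₀, hT₀, -⟩ := exists_admissible hX hc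
  have h := le_treeLen (a := dist (corner x) (corner y) - 2) ⟨T₀, hT₀⟩ fun T hT => by
    obtain ⟨p, hpT, hpx⟩ := hT.meets x hx
    obtain ⟨q, hqT, hqy⟩ := hT.meets y hy
    have h1 : dist (corner x) p ≤ 1 := dist_le_one_of_mem_cube (corner_mem_cube x) hpx
    have h2 : dist q (corner y) ≤ 1 := dist_le_one_of_mem_cube hqy (corner_mem_cube y)
    have h3 : dist p q ≤ len T := dist_le_len hT.connected.isPreconnected hpT hqT
    have h4 := dist_triangle4 (corner x) p q (corner y)
    linarith
  linarith

/-- ℓ¹ versus sup: ∣x − y∣₁ ≤ d · dist_∞(x, y) for lattice points. [folklore] -/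
theorem l1_sub_le_dist (x y : Pt d) : l1 (x - y) ≤ d * dist (corner x) (corner y) := by
  unfold B12Sec2to5.l1
  have h : ∀ μ, |((x - y) μ : ℝ)| ≤ dist (corner x) (corner y) := fun μ => by
    have h1 := dist_le_pi_dist (corner x) (corner y) μ
    rw [Real.dist_eq] at h1
    simpa [corner, Pi.sub_apply, Int.cast_sub] using h1
  calc ∑ μ, |((x - y) μ : ℝ)| ≤ ∑ _μ : Fin d, dist (corner x) (corner y) := Finset.sum_le_sum fun μ _ => h μ
    _ = d * dist (corner x) (corner y) := by simp

/-- **∣x − y∣₁ ≤ d(d_j(X) + 2) for two cubes x, y of a localization domain X** — the diameter statement `hdiam` of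
`B12Decay510.geomLeaf_of_diam` in the window model, with (M, c₁) = (d, 2). (Locus of the DEFINITION of d_j: Balaban1987RG1 p.257; the bound itself is NOT PRINTED in B12 — it is
derived here.) [folklore] -/
theorem l1_sub_le_treeLen {X : Finset (Pt d)} (hX : X.Nonempty) (hc : FaceConnected X) {x y : Pt d}
    (hx : x ∈ X) (hy : y ∈ X) : l1 (x - y) ≤ d * (treeLen X + 2) :=
  (l1_sub_le_dist x y).trans (mul_le_mul_of_nonneg_left (dist_corner_le_treeLen hX hc hx hy) (Nat.cast_nonneg d))

/-! ## 2. The site geometry of a window and its three leaves -/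

/-- ∣−z∣₁ = ∣z∣₁. [folklore] -/
theorem l1_neg (z : Pt d) : l1 (-z) = l1 z := by
  unfold B12Sec2to5.l1
  simp [abs_neg]

/-- ∣x − y∣₁ is symmetric. [folklore] -/
theorem l1_sub_comm (x y : Pt d) : l1 (x - y) = l1 (y - x) := by
  rw [← l1_neg, neg_sub]

/-- The ℓ¹ triangle inequality ∣x + y∣₁ ≤ ∣x∣₁ + ∣y∣₁. [folklore] -/
theorem l1_add_le (x y : Pt d) : l1 (x + y) ≤ l1 x + l1 y := by
  unfold B12Sec2to5.l1
  rw [← Finset.sum_add_distrib]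
  exact Finset.sum_le_sum fun μ _ => by
    simpa [Pi.add_apply, Int.cast_add] using abs_add_le (x μ : ℝ) (y μ : ℝ)

/-- ∣x − z∣₁ ≤ ∣x − y∣₁ + ∣y − z∣₁. [folklore] -/
theorem l1_sub_triangle (x y z : Pt d) : l1 (x - z) ≤ l1 (x - y) + l1 (y - z) := by
  have h := l1_add_le (x - y) (y - z)
  rwa [sub_add_sub_cancel] at h

/-- A cube of the domain X nearest to the site z in the ℓ¹ distance exists (X is a non-empty finite family).
[folklore] -/
theorem exists_nearest (B : Finset (Pt d)) (z : Pt d) (X : Dom B) :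
    ∃ p ∈ X.1, ∀ p' ∈ X.1, l1 (z - p) ≤ l1 (z - p') :=
  Finset.exists_min_image X.1 (fun p => l1 (z - p)) X.2.2.1

/-- A chosen nearest cube of X to z. [folklore] -/
noncomputable def nearest (B : Finset (Pt d)) (z : Pt d) (X : Dom B) : Pt d :=
  Classical.choose (exists_nearest B z X)

/-- The nearest cube belongs to the domain. [folklore] -/
theorem nearest_mem (B : Finset (Pt d)) (z : Pt d) (X : Dom B) : nearest B z X ∈ X.1 :=
  (Classical.choose_spec (exists_nearest B z X)).1

/-- The nearest cube minimizes the distance. [folklore] -/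
theorem nearest_le (B : Finset (Pt d)) (z : Pt d) (X : Dom B) {p : Pt d} (hp : p ∈ X.1) :
    l1 (z - nearest B z X) ≤ l1 (z - p) :=
  (Classical.choose_spec (exists_nearest B z X)).2 p hp

/-- **The `SiteGeometry` of a window** (p. 257 [9]: the cubes π_j, the localization domains as unions of cubes,
dist(x, □), dist(x, X) = min_{□⊂X} dist(x, □)) — sites := ℤᵈ (cube indices), dist(z, □) := ∣z − □∣₁,
dist(z, X) := ∣z − nearest cube of X∣₁, the chosen cube `pick z X` := that nearest cube. [cite: Balaban1987RG1, §0 p.257] -/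
noncomputable def geom (B : Finset (Pt d)) : SiteGeometry (cubeSys B).toCubeCover (Pt d) where
  distC := fun z c => l1 (z - c.1)
  distD := fun z X => l1 (z - nearest B z X)
  distC_nonneg := fun _ _ => l1_nonneg _
  distD_nonneg := fun _ _ => l1_nonneg _
  pick := fun z X => ⟨nearest B z X, X.2.1 (nearest_mem B z X)⟩
  pick_mem := fun z X => by
    show X ∈ (cubeSys B).above _
    rw [CubeSystem.mem_above]
    exact mem_cellsOf.2 (nearest_mem B z X)
  distC_pick_le := fun _ _ => le_rfl

/-- dist(z, X) of the window geometry, unfolded. [folklore] -/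
@[simp] theorem geom_distD (B : Finset (Pt d)) (z : Pt d) (X : Dom B) :
    (geom B).distD z X = l1 (z - nearest B z X) := rfl

/-- dist(z, □) of the window geometry, unfolded. [folklore] -/
@[simp] theorem geom_distC (B : Finset (Pt d)) (z : Pt d) (c : Cell B) :
    (geom B).distC z c = l1 (z - c.1) := rfl

/-- **Leaf (b), the geometry leaf, PROVED for windows**: ∣x − y∣₁ ≤ dist(x, X) + dist(y, X) + d(d_j(X) + 2)
(`B12Decay510.geomLeaf_of_diam` on `l1_sub_le_treeLen`). [cite: Balaban1987RG1, §0 p.257] -/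
theorem geomLeaf (B : Finset (Pt d)) : GeomLeaf (geom B) (fun x y => l1 (x - y)) d 2 := by
  refine geomLeaf_of_diam (geom B) (fun p (X : Dom B) => p ∈ X.1) (fun a b => l1_sub_comm a b)
    (fun a b c => l1_sub_triangle a b c) (fun X p q hp hq => ?_)
    (fun x X => ⟨nearest B x X, nearest_mem B x X, le_rfl⟩)
  exact l1_sub_le_treeLen X.2.2.1 X.2.2.2 hp hq

/-- The lattice constant K₁(a) = Σ_{z∈ℤᵈ} e^{−a∣z∣₁} of the cube-sum leaf. [folklore] -/
noncomputable def K₁ (d : ℕ) (a : ℝ) : ℝ := ∑' z : Pt d, Real.exp (-a * l1 z)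

/-- K₁(a) ≥ 0. [folklore] -/
theorem K₁_nonneg (d : ℕ) (a : ℝ) : 0 ≤ K₁ d a :=
  tsum_nonneg fun _ => (Real.exp_pos _).le

/-- **Leaf (c), the cube-sum leaf, PROVED for windows**: Σ_{□∈B} e^{−a∣z − □∣₁} ≤ Σ_{w∈ℤᵈ} e^{−a∣w∣₁} = K₁(a)
for a > 0, uniformly in the site z and the window (`B12Sec2to5.summable_exp_neg_l1`). [cite: Balaban1987RG1, (5.10) p.293] -/
theorem cubeSumLeaf (B : Finset (Pt d)) {a : ℝ} (ha : 0 < a) : CubeSumLeaf (geom B) a (K₁ d a) := by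
  intro z
  have hs := B12Sec2to5.summable_exp_neg_l1 ha d
  have h1 : ∑ c : Cell B, Real.exp (-a * (geom B).distC z c) = ∑ p ∈ B, Real.exp (-a * l1 (z - p)) := by
    simp only [geom_distC]
    exact (Finset.sum_subtype B (fun _ => Iff.rfl) (fun p => Real.exp (-a * l1 (z - p)))).symm
  have h2 : ∑ p ∈ B, Real.exp (-a * l1 (z - p)) = ∑ w ∈ B.image (fun p => z - p), Real.exp (-a * l1 w) := by
    rw [Finset.sum_image]
    intro p _ q _ h
    exact sub_right_injective h
  calc ∑ c : ((cubeSys B).toCubeCover).Cube, Real.exp (-a * (geom B).distC z c)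
      = ∑ p ∈ B, Real.exp (-a * l1 (z - p)) := h1
    _ = ∑ w ∈ B.image (fun p => z - p), Real.exp (-a * l1 w) := h2
    _ ≤ K₁ d a := hs.sum_le_tsum _ fun w _ => (Real.exp_pos _).le

/-- **Leaf (d), the domain-sum (tree) leaf, for windows** — `B12Decay510.treeLeaf_of_volumeLeaf` on the degree
bound and the volume leaf PROVED in `TreeLengthCubeSystem`: Σ_{X⊃□} e^{−(κ/2)d_j(X)} ≤ K₀(4·2ᵈ, 2d) once
κ/2 ≥ κ₀(4·2ᵈ, 2d) (B12 p.257 prints «with a sufficiently large constant κ» after (0.25); the words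
*"for κ sufficiently large"* are [II]'s, printed right after (1.26), CMP 116 p.8).
[cite: Balaban1987RG1, (0.25)–(0.26) p.257] [cite: Balaban1988RG2Cluster, (1.26) p.8] -/
theorem treeLeaf (B : Finset (Pt d)) {κ : ℝ} (hκ : kappa₀ (4 * 2 ^ d) (2 * d) ≤ κ / 2) :
    TreeLeaf (cubeSys B).toCubeCover (κ / 2) (K₀ (4 * 2 ^ d) (2 * d)) :=
  treeLeaf_of_volumeLeaf (cubeSys B) (degreeLE B) (volumeLeaf B) hκ

/-! ## 3. (5.10) on a window and on an exhausting family of windows, geometric leaves discharged -/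

/-- **(5.10) on one window, every geometric leaf discharged**: with the terms 𝐀 ↦ 𝐄^{(j)}(X, exp iξ𝐀) analytic
on the (4.4)-ball of radius α₂ and bounded there by E₀e^{−κd_j(X)} ((1.18)), the kernel = the real part of the
mixed τ-derivative on the pair of minimizer responses ((4.35) at r = 2), the responses bounded by B₃e^{−δ₀dist(x,X)}
(p. 282), δ₀ > 0 and κ ≥ 2κ₀(4·2ᵈ, 2d):
∣Σ_X 𝐄^{(2)}(X, x, y)∣ ≤ 4E₀α₂⁻² B₃² e^{2dδ₁} K₀ K₁(δ₀/2) e^{−δ₁∣x − y∣₁}, δ₁ = ½ min{δ₀, κ/d}. [cite: Balaban1987RG1, (5.10) p.293] -/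
theorem abs_twoPoint_le_window (hd : 0 < d) (B : Finset (Pt d)) {W : Type*} [NormedAddCommGroup W]
    [NormedSpace ℂ W] (EX : Dom B → W → ℂ) (h : Dom B → Pt d → W) (E2 : Dom B → Pt d → Pt d → ℝ)
    {α₂ E₀ B₃ κ δ₀ : ℝ} (hα₂ : 0 < α₂) (hE₀ : 0 ≤ E₀) (hB₃ : 0 ≤ B₃) (hδ₀ : 0 < δ₀)
    (hκ : kappa₀ (4 * 2 ^ d) (2 * d) ≤ κ / 2)
    (han : ∀ X, AnalyticOnNhd ℂ (EX X) (ball 0 α₂))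
    (h118 : ∀ X, ∀ v ∈ ball (0 : W) α₂, ‖EX X v‖ ≤ E₀ * Real.exp (-κ * treeLen X.1))
    (hrepr : ∀ X x y, E2 X x y = (mixedDeriv (EX X) (h X x) (h X y)).re)
    (hh : ∀ X x, ‖h X x‖ ≤ B₃ * Real.exp (-δ₀ * l1 (x - nearest B x X))) (x y : Pt d) :
    |∑ X : Dom B, E2 X x y| ≤ 4 * E₀ / α₂ ^ 2 * B₃ ^ 2 * Real.exp (delta1 δ₀ κ d * d * 2) *
      K₀ (4 * 2 ^ d) (2 * d) * K₁ d (δ₀ / 2) * Real.exp (-(delta1 δ₀ κ d) * l1 (x - y)) := by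
  have hκ0 : 0 ≤ κ := by
    have := kappa₀_nonneg (c₀ := 4 * 2 ^ d) (by positivity) (2 * d)
    linarith
  have hdR : (0 : ℝ) < d := Nat.cast_pos.2 hd
  exact abs_twoPoint_le_of_analytic (S := sys B) (geom B) (ρ := fun x y => l1 (x - y)) EX h E2 hα₂ hE₀ hB₃
    (K₀_pos _ _).le hδ₀.le hκ0 hdR han h118 hrepr hh (geomLeaf B) (cubeSumLeaf B (half_pos hδ₀))
    (treeLeaf B hκ) x y

/-- **(5.10) = `B12Sec2to5.Decay510` for an exhausting family of windows, every geometric leaf discharged**: the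
same analytic hypotheses on each window `B n` and the limit (5.1) of the finite-window kernels at the sites 0, z
⇒ `Decay510 P (4E₀α₂⁻² B₃² e^{2dδ₁} K₀(4·2ᵈ,2d) K₁(δ₀/2)) δ₁` with δ₁ = `delta1 δ₀ κ d` = ½ min{δ₀, κ/d} — the
window-model form of (5.10) p. 293 with its example constant, the printed M read as the norm-conversion factor d of
the unit-cube picture (module docstring, DIVERGENCE). [cite: Balaban1987RG1, (5.10) p.293] -/
theorem decay510_window (hd : 0 < d) (B : ℕ → Finset (Pt d)) (Wn : ℕ → Type*)
    [∀ n, NormedAddCommGroup (Wn n)] [∀ n, NormedSpace ℂ (Wn n)]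
    (EXn : (n : ℕ) → Dom (B n) → Wn n → ℂ) (hn : (n : ℕ) → Dom (B n) → Pt d → Wn n)
    (E2n : (n : ℕ) → Dom (B n) → Pt d → Pt d → ℝ) (P : Pt d → ℝ) {α₂ E₀ B₃ κ δ₀ : ℝ}
    (hα₂ : 0 < α₂) (hE₀ : 0 ≤ E₀) (hB₃ : 0 ≤ B₃) (hδ₀ : 0 < δ₀) (hκ : kappa₀ (4 * 2 ^ d) (2 * d) ≤ κ / 2)
    (han : ∀ n X, AnalyticOnNhd ℂ (EXn n X) (ball 0 α₂))
    (h118 : ∀ n X, ∀ v ∈ ball (0 : Wn n) α₂, ‖EXn n X v‖ ≤ E₀ * Real.exp (-κ * treeLen X.1))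
    (hrepr : ∀ n X x y, E2n n X x y = (mixedDeriv (EXn n X) (hn n X x) (hn n X y)).re)
    (hh : ∀ n X x, ‖hn n X x‖ ≤ B₃ * Real.exp (-δ₀ * l1 (x - nearest (B n) x X)))
    (hlim : ∀ z, Tendsto (fun n => ∑ X : Dom (B n), E2n n X 0 z) atTop (𝓝 (P z))) :
    B12Sec2to5.Decay510 P (4 * E₀ / α₂ ^ 2 * B₃ ^ 2 * Real.exp (delta1 δ₀ κ d * d * 2) *
      K₀ (4 * 2 ^ d) (2 * d) * K₁ d (δ₀ / 2)) (delta1 δ₀ κ d) := by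
  have hκ0 : 0 ≤ κ := by
    have := kappa₀_nonneg (c₀ := 4 * 2 ^ d) (by positivity) (2 * d)
    linarith
  have hdR : (0 : ℝ) < d := Nat.cast_pos.2 hd
  refine decay510_of_analytic_leaves (fun n => sys (B n)) (fun n => (cubeSys (B n)).toCubeCover) (fun _ => Pt d)
    (fun n => geom (B n)) (fun _ x y => l1 (x - y)) Wn EXn hn E2n (fun _ z => z) P hα₂ hE₀ hB₃ (K₀_pos _ _).le
    hδ₀.le hκ0 hdR han h118 hrepr hh (fun n => geomLeaf (B n)) (fun n => cubeSumLeaf (B n) (half_pos hδ₀))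
    (fun n => treeLeaf (B n) hκ) (fun z => Eventually.of_forall fun n => ?_) hlim
  show l1 (0 - z) = l1 z
  rw [zero_sub, l1_neg]

end Literature.MathematicalPhysics.QuantumFieldTheory.Balaban1983to89.B12Decay510Window
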